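import Summits.NavierStokesRegularity.NavierStokesRegularity.Theorems.QuantisedSymmetryPolyhedralDssProfileExistsOfCell
import Literature.Analysis.FluidPDE.OseenMildUniqueness
import Literature.Analysis.FluidPDE.ChaeWolfRemovingDSSBounds
import HarnessLib

/-!
# No small cells — crux stmt-NavierStokesRegularity-1404 (`QuantisedSymmetry.PolyhedralDssProfileExists`),
  line polyhedral_cell: the ε-regularity removal in cell language

Two consequences of the reduction `typeIDss_of_cell` (file `…OfCell.lean`) for the line's only open
stub `stub_polyhedralCellExists` (∃ a nontrivial polyhedral cell with `L⁴` datum):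

* `concat_eq_cell` — **the concatenation extends the cell**: the Type-I DSS field `u` produced from a
  cell `v` agrees with `v` on the whole closed model period `[-1, -c⁻²]` (uniqueness of bounded
  solutions of the Oseen integral equation from the common datum `u(-1) = v(-1)`,
  `oseenMild_bounded_unique`, continuity of both, and the zoom at the right end point).
* `stub_noSmallCell` (registered) — **small cells are trivial**: there is an absolute `ε₀ > 0` such
  that every cell (any `G`, any `c > 1`) with `L⁴` datum and `√(-t) ‖v(t, x)‖ ≤ ε₀` on the model
  period has `v(-1) = 0`. The scale-invariant smallness propagates from the period to the whole past
  along the exact self-similarity of `u`, and Chae–Wolf 2017, proof of Thm 1.3, Step 1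
  (`ChaeWolf.exists_eps_typeI_small_eq_zero`: Type-I classical solutions with a small scale-invariant
  bound vanish; Gustafson–Kang–Tsai ε-regularity, Chae–Wolf Rem. 1.4) kills `u`, hence `v(-1) = u(-1) = 0`.
  So a witness of the ∃-stub is LARGE: `sup_{[-1,-c⁻²]×ℝ³} √(-t)|v| > ε₀`.
-/

noncomputable section

-- the summit namespace `…NavierStokesRegularity.NavierStokesRegularity…` is the tree convention (D-0017)
set_option linter.dupNamespace false

namespace Summit.NavierStokesRegularity.NavierStokesRegularity.Theorems.PolyhedralDssProfileExists.PolyhedralCell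

open MeasureTheory Set Function Filter Topology
open Literature.Analysis Literature.Analysis.FluidPDE

/-- **The concatenation extends the cell.** Let `v` be a cell on `[-1, -c⁻²]` (`c > 1`: jointly
continuous, bounded, Oseen-mild between all pairs of model times, closing up under the zoom) and let
`u` be a field on the past which is jointly continuous, Oseen-mild between all pairs `s < t < 0`,
obeys a Type-I time rate, is exactly `c`-DSS and has `u(-1) = v(-1)`. Then `u(t) = v(t)` for every
`t ∈ [-1, -c⁻²]`: on the open period both solve the Oseen integral equation from the same datum at
`s = -1` and are bounded, so they agree a.e. (`oseenMild_bounded_unique`), hence everywhere (both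
slices are continuous); at `t = -c⁻²` the zoom gives `u(-c⁻², x) = c u(-1, cx) = c v(-1, cx) = v(-c⁻², x)`. -/
theorem concat_eq_cell {c : ℝ} (hc : 1 < c)
    {v u : ℝ → EuclideanSpace ℝ (Fin 3) → EuclideanSpace ℝ (Fin 3)} {M C : ℝ}
    (hvcont : ContinuousOn (Function.uncurry v) (Set.Icc (-1 : ℝ) (-(c ^ 2)⁻¹) ×ˢ Set.univ))
    (hvM : ∀ t ∈ Set.Icc (-1 : ℝ) (-(c ^ 2)⁻¹), ∀ x, ‖v t x‖ ≤ M)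
    (hvmild : ∀ s t : ℝ, -1 ≤ s → s < t → t ≤ -(c ^ 2)⁻¹ → ∀ x,
      v t x = heatFlow (v s) (t - s) x - oseenDuhamel 1 s v v t x)
    (hjump : ∀ x, v (-(c ^ 2)⁻¹) x = c • v (-1) (c • x))
    (hucont : ContinuousOn (Function.uncurry u) (Set.Iio 0 ×ˢ Set.univ))
    (humild : ∀ s t : ℝ, s < t → t < 0 → ∀ x,
      u t x = heatFlow (u s) (t - s) x - oseenDuhamel 1 s u u t x)
    (hI : HasTypeITimeDecay C u) (hdss : IsDiscretelySelfSimilar c u) (hu1 : u (-1) = v (-1)) :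
    ∀ t ∈ Set.Icc (-1 : ℝ) (-(c ^ 2)⁻¹), u t = v t := by
  have hc0 : 0 < c := one_pos.trans hc
  have hq : 1 < c ^ 2 := by nlinarith
  have hq0 : 0 < c ^ 2 := by positivity
  have hqinv : (c ^ 2)⁻¹ < 1 := inv_lt_one_of_one_lt₀ hq
  have hqinv0 : 0 < (c ^ 2)⁻¹ := inv_pos.2 hq0
  set T : ℝ := -(c ^ 2)⁻¹ with hT
  have hT0 : T < 0 := by rw [hT]; linarith
  have h1T : (-1 : ℝ) < T := by rw [hT]; linarith
  -- the a.e. identification on the open period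
  have hae : ∀ t ∈ Ioo (-1 : ℝ) T, u t =ᵐ[volume] v t := by
    -- bounds
    have hC0 : 0 ≤ C := by
      have h := hI (-1) (by norm_num) 0
      rw [neg_neg, Real.sqrt_one, div_one] at h
      exact (norm_nonneg _).trans h
    have hM0 : 0 ≤ M := (norm_nonneg _).trans (hvM (-1) ⟨le_rfl, h1T.le⟩ 0)
    set K : ℝ := max (C / Real.sqrt (-T)) M with hK
    have hK0 : 0 ≤ K := hM0.trans (le_max_right _ _)
    have huK : ∀ τ ∈ Ioo (-1 : ℝ) T, ∀ y, ‖u τ y‖ ≤ K := by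
      intro τ hτ y
      have hτ0 : τ < 0 := hτ.2.trans hT0
      refine ((hI τ hτ0 y).trans ?_).trans (le_max_left _ _)
      exact div_le_div_of_nonneg_left hC0 (Real.sqrt_pos.2 (neg_pos.2 hT0))
        (Real.sqrt_le_sqrt (by linarith [hτ.2]))
    have hvK : ∀ τ ∈ Ioo (-1 : ℝ) T, ∀ y, ‖v τ y‖ ≤ K :=
      fun τ hτ y => (hvM τ ⟨hτ.1.le, hτ.2.le⟩ y).trans (le_max_right _ _)
    -- measurability from continuity
    have hum : AEStronglyMeasurable (uncurry u)
        ((volume : Measure (ℝ × EuclideanSpace ℝ (Fin 3))).restrict (Ioo (-1 : ℝ) T ×ˢ univ)) :=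
      (hucont.mono (prod_mono (fun τ hτ => hτ.2.trans hT0) subset_rfl)).aestronglyMeasurable
        (measurableSet_Ioo.prod MeasurableSet.univ)
    have hvm : AEStronglyMeasurable (uncurry v)
        ((volume : Measure (ℝ × EuclideanSpace ℝ (Fin 3))).restrict (Ioo (-1 : ℝ) T ×ˢ univ)) :=
      (hvcont.mono (prod_mono Ioo_subset_Icc_self subset_rfl)).aestronglyMeasurable
        (measurableSet_Ioo.prod MeasurableSet.univ)
    -- the two Oseen identities from the common datum at `s = -1`
    have hu : ∀ t ∈ Ioo (-1 : ℝ) T, u t =ᵐ[volume] fun x =>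
        UnboundedOperators.heatExtension (v (-1)) (1 * (t - (-1))) x - oseenDuhamel 1 (-1) u u t x := by
      intro t ht
      refine Eventually.of_forall fun x => ?_
      have h := humild (-1) t ht.1 (ht.2.trans hT0) x
      rw [heatFlow_of_pos _ (by linarith [ht.1]), hu1] at h
      rw [one_mul]
      exact h
    have hv : ∀ t ∈ Ioo (-1 : ℝ) T, v t =ᵐ[volume] fun x =>
        UnboundedOperators.heatExtension (v (-1)) (1 * (t - (-1))) x - oseenDuhamel 1 (-1) v v t x := by
      intro t ht
      refine Eventually.of_forall fun x => ?_
      have h := hvmild (-1) t le_rfl ht.1 ht.2.le x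
      rw [heatFlow_of_pos _ (by linarith [ht.1])] at h
      rw [one_mul]
      exact h
    exact oseenMild_bounded_unique one_pos hK0 hum hvm huK hvK hu hv
  -- continuity of the slices
  have hus : ∀ t < 0, Continuous (u t) := fun t ht =>
    hucont.comp_continuous (continuous_const.prodMk continuous_id) fun y => ⟨mem_Iio.2 ht, mem_univ y⟩
  have hvs : ∀ t ∈ Icc (-1 : ℝ) T, Continuous (v t) := fun t ht =>
    hvcont.comp_continuous (continuous_const.prodMk continuous_id) fun y => ⟨ht, mem_univ y⟩
  intro t ht
  rcases ht.2.lt_or_eq with hlt | heq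
  · rcases ht.1.lt_or_eq with hgt | heq'
    · exact Measure.eq_of_ae_eq (hae t ⟨hgt, hlt⟩) (hus t (hlt.trans hT0)) (hvs t ht)
    · rw [← heq']; exact hu1
  · -- the right end point by the zoom
    funext x
    have key := congrFun (congrFun hdss T) x
    rw [nsRescale_apply] at key
    have hcT : c ^ 2 * T = -1 := by
      rw [hT, mul_neg, mul_inv_cancel₀ hq0.ne']
    rw [heq, ← key, hcT, hu1, hT, hjump]

/-! ### Scale invariance of the smallness condition -/

/-- **The scale-invariant quantity `√(-t)‖u(t, x)‖` of an exactly `c`-DSS field takes the same values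
on the slices `s`, `c² s` and `s/c²`**: a bound `√(-s)‖u(s, ·)‖ ≤ ε` at one time propagates one
zoom up and one zoom down. -/
theorem small_zoom_of_dss {c : ℝ} (hc : 0 < c)
    {u : ℝ → EuclideanSpace ℝ (Fin 3) → EuclideanSpace ℝ (Fin 3)} (hdss : IsDiscretelySelfSimilar c u)
    {ε s : ℝ} (h : ∀ x, Real.sqrt (-s) * ‖u s x‖ ≤ ε) :
    (∀ y, Real.sqrt (-(c ^ 2 * s)) * ‖u (c ^ 2 * s) y‖ ≤ ε) ∧
      (∀ y, Real.sqrt (-(s / c ^ 2)) * ‖u (s / c ^ 2) y‖ ≤ ε) := by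
  have hc2 : (c ^ 2 : ℝ) ≠ 0 := by positivity
  constructor
  · intro y
    have key : c • u (c ^ 2 * s) y = u s (c⁻¹ • y) := by
      have := congrFun (congrFun hdss s) (c⁻¹ • y)
      rwa [nsRescale_apply, smul_inv_smul₀ hc.ne'] at this
    have hn : c * ‖u (c ^ 2 * s) y‖ = ‖u s (c⁻¹ • y)‖ := by
      have := congrArg norm key
      rwa [norm_smul, Real.norm_of_nonneg hc.le] at this
    have hsq : Real.sqrt (-(c ^ 2 * s)) = c * Real.sqrt (-s) := by
      rw [show -(c ^ 2 * s) = c ^ 2 * (-s) by ring, Real.sqrt_mul (sq_nonneg c), Real.sqrt_sq hc.le]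
    calc Real.sqrt (-(c ^ 2 * s)) * ‖u (c ^ 2 * s) y‖
        = Real.sqrt (-s) * (c * ‖u (c ^ 2 * s) y‖) := by rw [hsq]; ring
      _ = Real.sqrt (-s) * ‖u s (c⁻¹ • y)‖ := by rw [hn]
      _ ≤ ε := h _
  · intro y
    have key : c • u s (c • y) = u (s / c ^ 2) y := by
      have := congrFun (congrFun hdss (s / c ^ 2)) y
      rwa [nsRescale_apply, mul_div_cancel₀ _ hc2] at this
    have hn : ‖u (s / c ^ 2) y‖ = c * ‖u s (c • y)‖ := by
      rw [← key, norm_smul, Real.norm_of_nonneg hc.le]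
    have hsq : Real.sqrt (-(s / c ^ 2)) = Real.sqrt (-s) / c := by
      rw [show -(s / c ^ 2) = -s / c ^ 2 by ring, Real.sqrt_div' _ (sq_nonneg c), Real.sqrt_sq hc.le]
    calc Real.sqrt (-(s / c ^ 2)) * ‖u (s / c ^ 2) y‖
        = Real.sqrt (-s) * ‖u s (c • y)‖ := by rw [hsq, hn]; field_simp
      _ ≤ ε := h _

/-- **Smallness on one period is smallness everywhere** for an exactly `c`-DSS field (`c > 1`): if
`√(-t)‖u(t, x)‖ ≤ ε` for all `t ∈ [-1, -c⁻²]` and all `x`, then for all `t < 0` and all `x`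
(every negative time is a zoom image of a model time, `exists_slabIdx`, `zoom_time_mem`). -/
theorem small_all_of_small_period {c : ℝ} (hc : 1 < c)
    {u : ℝ → EuclideanSpace ℝ (Fin 3) → EuclideanSpace ℝ (Fin 3)} (hdss : IsDiscretelySelfSimilar c u)
    {ε : ℝ} (h : ∀ t ∈ Set.Icc (-1 : ℝ) (-(c ^ 2)⁻¹), ∀ x, Real.sqrt (-t) * ‖u t x‖ ≤ ε) :
    ∀ t < 0, ∀ x, Real.sqrt (-t) * ‖u t x‖ ≤ ε := by
  have hc0 : 0 < c := one_pos.trans hc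
  have hq : 1 < c ^ 2 := by nlinarith
  have hq0 : 0 < c ^ 2 := by positivity
  -- transport along all integer powers of the zoom
  have hall : ∀ k : ℤ, ∀ t' : ℝ, (∀ x, Real.sqrt (-t') * ‖u t' x‖ ≤ ε) →
      ∀ x, Real.sqrt (-((c ^ 2) ^ k * t')) * ‖u ((c ^ 2) ^ k * t') x‖ ≤ ε := by
    intro k
    induction k using Int.induction_on with
    | zero => intro t' ht'; simpa only [zpow_zero, one_mul] using ht'
    | succ i ih =>
        intro t' ht'
        have e : (c ^ 2) ^ ((i : ℤ) + 1) * t' = c ^ 2 * ((c ^ 2) ^ (i : ℤ) * t') := by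
          rw [zpow_add_one₀ hq0.ne']; ring
        rw [e]
        exact (small_zoom_of_dss hc0 hdss (ih t' ht')).1
    | pred i ih =>
        intro t' ht'
        have e : (c ^ 2) ^ (-(i : ℤ) - 1) * t' = (c ^ 2) ^ (-(i : ℤ)) * t' / c ^ 2 := by
          rw [zpow_sub_one₀ hq0.ne']; ring
        rw [e]
        exact (small_zoom_of_dss hc0 hdss (ih t' ht')).2
  intro t ht x
  obtain ⟨k, hk1, hk2⟩ := exists_slabIdx hq ht
  have hmem := zoom_time_mem hc0 k (t := t) (by linarith) (by linarith)
  have e : (c ^ 2) ^ k * ((c ^ (-k)) ^ 2 * t) = t := by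
    rw [← mul_assoc, mul_comm ((c ^ 2) ^ k), zoom_sq_mul hc0 k, one_mul]
  have key := hall k ((c ^ (-k)) ^ 2 * t) (h _ hmem) x
  rwa [e] at key

/-! ### The registered necessary condition -/

/-- **REGISTERED NECESSARY CONDITION `stub_noSmallCell`: small cells are trivial** (the ε-regularity
removal of Chae–Wolf 2017 Rem. 1.4 / proof of Thm 1.3 Step 1, Gustafson–Kang–Tsai, in cell language).
There is an absolute `ε₀ > 0` such that for every subgroup `G` of the linear isometries of `ℝ³`,
every `c > 1` and every `G`-cell `v` on `[-1, -c⁻²]` with `v(-1) ∈ L⁴`: if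
`√(-t) ‖v(t, x)‖ ≤ ε₀` for all model times `t` and all `x`, then `v(-1) = 0`. Proof: the Type-I DSS
classical solution `u` of `typeIDss_of_cell` extends `v` (`concat_eq_cell`), so the scale-invariant
smallness holds on one period of `u`, hence on the whole past (`small_all_of_small_period`), and
`ChaeWolf.exists_eps_typeI_small_eq_zero` forces `u ≡ 0` on the past; `v(-1) = u(-1) = 0`.
Consequently every witness of the ∃-stub `stub_polyhedralCellExists` is LARGE in the scale-invariant
norm: `sup √(-t)|v| > ε₀` on the model period. -/
theorem stub_noSmallCell :
    ∃ ε₀ : ℝ, 0 < ε₀ ∧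
      ∀ (G : Subgroup (EuclideanSpace ℝ (Fin 3) ≃ₗᵢ[ℝ] EuclideanSpace ℝ (Fin 3))) (c : ℝ), 1 < c →
      ∀ v : ℝ → EuclideanSpace ℝ (Fin 3) → EuclideanSpace ℝ (Fin 3),
        (ContinuousOn (Function.uncurry v) (Set.Icc (-1 : ℝ) (-(c ^ 2)⁻¹) ×ˢ Set.univ) ∧
          (∃ M : ℝ, ∀ t ∈ Set.Icc (-1 : ℝ) (-(c ^ 2)⁻¹), ∀ x, ‖v t x‖ ≤ M) ∧
          (∀ t ∈ Set.Icc (-1 : ℝ) (-(c ^ 2)⁻¹), IsWeaklyDivFree (v t)) ∧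
          (∀ s t : ℝ, -1 ≤ s → s < t → t ≤ -(c ^ 2)⁻¹ → ∀ x,
            v t x = heatFlow (v s) (t - s) x - oseenDuhamel 1 s v v t x) ∧
          (∀ x, v (-(c ^ 2)⁻¹) x = c • v (-1) (c • x)) ∧
          (∀ g ∈ G, ∀ t ∈ Set.Icc (-1 : ℝ) (-(c ^ 2)⁻¹), ∀ x, v t (g x) = g (v t x))) →
        MemLp (v (-1)) 4 volume →
        (∀ t ∈ Set.Icc (-1 : ℝ) (-(c ^ 2)⁻¹), ∀ x, Real.sqrt (-t) * ‖v t x‖ ≤ ε₀) →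
        v (-1) = 0 := by
  obtain ⟨ε₀, hε₀, hsmall⟩ := ChaeWolf.exists_eps_typeI_small_eq_zero
  refine ⟨ε₀, hε₀, ?_⟩
  intro G c hc v hcell hL4 hsm
  obtain ⟨u, p, hcl, -, -, hdss, ⟨C₀, hC₀0, hC₀, hK⟩, -, hu1, -⟩ := typeIDss_of_cell G hc hcell hL4
  obtain ⟨hvcont, ⟨M, hvM⟩, -, hvmild, hjump, -⟩ := hcell
  have hper := concat_eq_cell hc hvcont hvM hvmild hjump hK.continuousOn_uncurry
    (fun s t hst ht x => hK.mild_eq hst ht x) hK.hasTypeITimeDecay hdss hu1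
  have hsmu : ∀ t < 0, ∀ x, Real.sqrt (-t) * ‖u t x‖ ≤ ε₀ :=
    small_all_of_small_period hc hdss fun t ht x => by rw [hper t ht]; exact hsm t ht x
  have hz := hsmall hC₀0 hcl hC₀ hsmu
  funext x
  have h1 := hz (-1) (by norm_num) x
  rw [hu1] at h1
  exact h1

end Summit.NavierStokesRegularity.NavierStokesRegularity.Theorems.PolyhedralDssProfileExists.PolyhedralCell

end
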